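import Summits.AtomisticToContinuum.HydrodynamicLimit.Theorems.MourreKoopmanChargesLinearToEntropyInBandDefsB
import HarnessLib

/-!
# `LinearToEntropyInBand` — ROUTE-INDEPENDENT split glue (strategist, `cstrat-stmt-AtomisticToContinuum-17740`)

Companion of `MourreKoopmanChargesLinearToEntropyInBandSplit.lean` (which states the split glue with the crux
BY NAME and therefore imports the route file).  The gate renders a `--glue-by` theorem INSIDE the route file
`Theses/MourreKoopmanCharges.lean` as `theorem LinearToEntropyInBandGlueBy_holds : C₁ → C₂ → C₃ → LinearToEntropyInBand :=
_root_.<glue_by>`, so the glue theorem must live in a module the route file can import — i.e. one that does NOT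
import the route file.  This module imports only the landed crux objects (`…DefsB`) and states the composition
polymorphically in the three route-side propositions (`RelEnt` = `MourreKoopmanCharges.RelEntropyVanishingInBand`,
`OBC` = `OneBodyCompleteness`, `SSM` = `StressStrongMixing`); at the render site they are fixed by unification
against the route decls (the crux is `OBC → SSM → RelEnt` by `rfl`, see `…Split.lean`).

Children of the split (route decls, rendered by the gate):
* `VisibleFluxGibbsPressure      := LTEInBand.VisibleFluxGibbsianity`
* `VisibleOneBlockLocalisation   := LTEInBand.VisibleFluxGibbsianity → LTEInBand.VisibleOneBlockEstimateInBand`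
* `YauClosureOfVisibleOneBlock   := LTEInBand.VisibleOneBlockEstimateInBand → MourreKoopmanCharges.RelEntropyVanishingInBand`
-/

namespace Summit.AtomisticToContinuum.HydrodynamicLimit.Theorems.LTEInBand

/-- **Split glue, route-independent form (kernel-checked, no `sorry`)**: visible flux-Gibbsianity, its
ball-wise localisation to the visible one-block estimate in band, and the entropy closure of that estimate into
any target `RelEnt` give `OBC → SSM → RelEnt` for arbitrary antecedents `OBC`, `SSM` — instantiated by the gate at
`RelEnt := RelEntropyVanishingInBand`, `OBC := OneBodyCompleteness`, `SSM := StressStrongMixing`, where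
`OBC → SSM → RelEnt` is the crux `LinearToEntropyInBand` by `rfl`. -/
theorem LinearToEntropyInBand_of_subs_poly {RelEnt OBC SSM : Prop} :
    VisibleFluxGibbsianity →
    (VisibleFluxGibbsianity → VisibleOneBlockEstimateInBand) →
    (VisibleOneBlockEstimateInBand → RelEnt) →
    (OBC → SSM → RelEnt) :=
  fun hA hB hC _ _ => hC (hB hA)

end Summit.AtomisticToContinuum.HydrodynamicLimit.Theorems.LTEInBand
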